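import Literature.AnabelianGeometry.SemiGraphs.CoveringGraphVertexFibres
import Literature.AnabelianGeometry.SemiGraphs.CoveringGraphEdgeFibres
import Literature.AnabelianGeometry.SemiGraphs.CompactInVerticialAtCoveringGraphCorollaries
import Literature.AnabelianGeometry.SemiGraphs.SpecialFibreTowerOfCoverings
import HarnessLib

/-!
# [SemiAnbd] Example 3.10: ONE special-fibre tower over `π₁^temp(𝒢)` with the actions of `Δ` on the vertices AND on
# the edges of its fibres `𝒢_i`, both through `Δ/N_i`, both fibre-transitive over `𝒢`

Mochizuki, *Semi-graphs of anabelioids*, Publ. RIMS **42** (2006), §3, Example 3.10, manuscript p. 44 l. 12–17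
[cite: MochizukiSemiAnbd2006, Ex 3.10 p.44] ("semi-graphs of anabelioids `𝒢_i`, `𝒢^c_i` on which `Δ_i` acts
faithfully"), Thm. 3.7 p. 40–41, Rmk. 2.2.1 p. 24; [IUTchI] proof of Prop. 2.4 (i) p. 50
[cite: Mochizuki2012, Prop 2.4(i) p.50].

PROOF-ONLY file (abc-iut cell, layer L3, seat abc-iut-L3-t2 gen 5, row «Ex310-VERTEX-FIBRES», part D).  ONE tower
`T` (as in `SpecialFibreTower.exists_of_coverings`: levels `N`, fibres `𝒢_{S_i}`, admissible kernels `1`) is delivered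
with, for every `i`, the vertex/edge maps `projV`, `projE` of `𝔾_i → 𝔾` and TWO homomorphisms `σ : Δ →* Perm(vertices)`,
`τ : Δ →* Perm(edges)` over `𝔾`, DERIVED from conjugation (dictionary laws on the `T.adm i`-images of the traces
`N_i ∩ K`, `K` verticial / edge-like), TRANSITIVE on the fibres of `projV` / `projE`, with `N_i` acting trivially; plus
the dictionaries (every vertex/edge carries a trace; every verticial / edge-like subgroup of `π₁^temp(𝒢_i)` is a trace;
base vertex/edge determined).  Extra hypotheses for the EDGE half: Thm. 3.7 (iii) AT `𝒢` (`CompactInVerticialAt 𝒢`, a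
theorem for finite `𝒢`; gives `EdgeLikeDistinctAt` at `𝒢` and at the `𝒢_{S_i}`) and the commensurable rigidity `hCT`
of the edge-like subgroups of `𝒢` (a theorem for graphs, `eq_of_commensurable_of_mem_edgeLikeSubgroupsAt`, and at
locally finite `𝒢`).  A private generic lemma turns a uniquely solvable, unital, composable specification into a
permutation action.  HONEST LIMITS: incidence (`σ`, `τ` as a morphism of semi-graphs) is not
treated; `hCT` is open in the tree for open edges (cusps); nothing here is about curves; no side is taken on
[IUTchIII] Cor. 3.12.
-/

noncomputable section

open CategoryTheory Topology

namespace Literature.AnabelianGeometry.SemiGraphs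

open Literature.AlgebraicGeometry.Frobenioids (IsSlimGroup IsConnectedObj)
open Literature.AlgebraicGeometry.Frobenioids.QuasiTemperoid.BTempConnected (isConnectedObj_of_transitive)
open ProfiniteSemiGraph

universe u

/-! ### Helpers -/

/-- **A uniquely solvable, unital, composable specification defines a permutation action.** [folklore] -/
private theorem exists_perm_hom_of_existsUnique {G : Type u} [Group G] {X : Type u} (spec : G → X → X → Prop)
    (hex : ∀ g x, ∃! w, spec g x w) (hone : ∀ x, spec 1 x x)
    (hmul : ∀ g h x y z, spec h x y → spec g y z → spec (g * h) x z) :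
    ∃ σ : G →* Equiv.Perm X, ∀ g x, spec g x (σ g x) := by
  classical
  let f : G → X → X := fun g x => (hex g x).exists.choose
  have hf : ∀ g x, spec g x (f g x) := fun g x => (hex g x).exists.choose_spec
  have hf1 : ∀ x, f 1 x = x := fun x => (hex 1 x).unique (hf 1 x) (hone x)
  have hfmul : ∀ g h x, f (g * h) x = f g (f h x) := fun g h x =>
    (hex (g * h) x).unique (hf (g * h) x) (hmul g h x _ _ (hf h x) (hf g (f h x)))
  let σ : G →* Equiv.Perm X :=
    { toFun := fun g =>
        { toFun := f g
          invFun := f g⁻¹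
          left_inv := fun x => by rw [← hfmul, inv_mul_cancel, hf1]
          right_inv := fun x => by rw [← hfmul, mul_inv_cancel, hf1] }
      map_one' := Equiv.ext fun x => hf1 x
      map_mul' := fun g h => Equiv.ext fun x => hfmul g h x }
  exact ⟨σ, fun g x => hf g x⟩

/-- Transport of `φ : U ⥲ π₁^temp(𝒢_S)` along `U = N`, remembering its effect on traces. [folklore] -/
private theorem exists_adm_of_eq'' {G H : Type u} [Group G] [TopologicalSpace G] [Group H] [TopologicalSpace H]
    {U N : Subgroup G} (h : U = N) (φ : U →ₜ* H) (hs : Function.Surjective φ) (ho : IsOpenMap φ)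
    (hk : φ.toMonoidHom.ker = ⊥) :
    ∃ ψ : N →ₜ* H, Function.Surjective ψ ∧ IsOpenMap ψ ∧ ψ.toMonoidHom.ker = ⊥ ∧
      ∀ K : Subgroup G, (K.subgroupOf N).map ψ.toMonoidHom = (K.subgroupOf U).map φ.toMonoidHom := by
  subst h; exact ⟨φ, hs, ho, hk, fun _ => rfl⟩

/-- `g (n K n⁻¹) g⁻¹ = (g n g⁻¹) (g K g⁻¹) (g n g⁻¹)⁻¹`. [folklore] -/
private theorem map_conj_conj_swap {G : Type u} [Group G] (K : Subgroup G) (g n : G) :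
    (K.map (MulAut.conj n).toMonoidHom).map (MulAut.conj g).toMonoidHom =
      (K.map (MulAut.conj g).toMonoidHom).map (MulAut.conj (g * n * g⁻¹)).toMonoidHom := by
  rw [Subgroup.map_map, Subgroup.map_map]; congr 1; ext x
  simp only [MonoidHom.coe_comp, MulEquiv.coe_toMonoidHom, Function.comp_apply, MulAut.conj_apply]; group

/-- `(g h) K (g h)⁻¹ = g (h K h⁻¹) g⁻¹`. [folklore] -/
private theorem map_conj_mul' {G : Type u} [Group G] (K : Subgroup G) (g h : G) :
    K.map (MulAut.conj (g * h)).toMonoidHom = (K.map (MulAut.conj h).toMonoidHom).map (MulAut.conj g).toMonoidHom :=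
  by rw [Subgroup.map_map, map_mul]; rfl

/-- `1 K 1⁻¹ = K`. [folklore] -/
private theorem map_conj_one' {G : Type u} [Group G] (K : Subgroup G) :
    K.map (MulAut.conj (1 : G)).toMonoidHom = K := by rw [map_one]; exact K.map_id

namespace SpecialFibreTower

variable {𝒢 : ProfiniteSemiGraph.{u}}

/-- **[SemiAnbd] Example 3.10 — one tower over `π₁^temp(𝒢)` with the `Δ`-actions on the vertices and on the edges of
its fibres.**  See the module docstring for the list of clauses. [cite: MochizukiSemiAnbd2006, Ex 3.10 p.44] -/
theorem exists_of_coverings_fibres (h37 : 𝒢.Thm37Hypotheses) (hsc : 𝒢.IsStrictlyCoherent)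
    (hCV : CompactInVerticialAt 𝒢) (c : TemperedPiChart 𝒢)
    (hCT : ∀ (e : 𝒢.graph.Edge) (L L' : Subgroup c.G), L ∈ edgeLikeSubgroups c e → L' ∈ edgeLikeSubgroups c e →
      Subgroup.Commensurable L L' → L = L')
    (N : ℕ → Subgroup c.G) (hanti : Antitone N) (hopen : ∀ i, IsOpen (N i : Set c.G))
    (hchar : ∀ (i) (φ : c.G ≃ₜ* c.G), (N i).map φ.toMulEquiv.toMonoidHom = N i)
    (hnormal : ∀ i, (N i).Normal) (hfi : ∀ i, (N i).FiniteIndex) (hexh : ∀ g : c.G, (∀ i, g ∈ N i) → g = 1) :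
    ∃ T : SpecialFibreTower c.G, T.N = N ∧ (∀ i, T.admKer i = ⊥) ∧
      ∀ i, ∃ (S : CovObj 𝒢) (hS : S.IsTempered) (_ : T.Gc i = S.coveringGraph)
        (projV : (T.Gc i).graph.Vertex → 𝒢.graph.Vertex) (projE : (T.Gc i).graph.Edge → 𝒢.graph.Edge)
        (σ : c.G →* Equiv.Perm (T.Gc i).graph.Vertex) (τ : c.G →* Equiv.Perm (T.Gc i).graph.Edge),
        IsConnectedObj (⟨S, hS⟩ : BTempCat 𝒢) ∧ Function.Surjective projV ∧ Function.Surjective projE ∧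
        -- vertices: dictionary
        (∀ x, ∃ K ∈ verticialSubgroups c (projV x),
          (K.subgroupOf (T.N i)).map (T.adm i).toMonoidHom ∈ verticialSubgroups (T.chart i) x) ∧
        (∀ x (H : Subgroup (T.chart i).G), H ∈ verticialSubgroups (T.chart i) x →
          ∃ K ∈ verticialSubgroups c (projV x), H = (K.subgroupOf (T.N i)).map (T.adm i).toMonoidHom) ∧
        (∀ (v : 𝒢.graph.Vertex) (K : Subgroup c.G) x, K ∈ verticialSubgroups c v →
          (K.subgroupOf (T.N i)).map (T.adm i).toMonoidHom ∈ verticialSubgroups (T.chart i) x → projV x = v) ∧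
        -- vertices: the action
        (∀ g x, projV (σ g x) = projV x) ∧
        (∀ g x (K : Subgroup c.G), K ∈ verticialSubgroups c (projV x) →
          (K.subgroupOf (T.N i)).map (T.adm i).toMonoidHom ∈ verticialSubgroups (T.chart i) x →
          ((K.map (MulAut.conj g).toMonoidHom).subgroupOf (T.N i)).map (T.adm i).toMonoidHom ∈
            verticialSubgroups (T.chart i) (σ g x)) ∧
        (∀ x₁ x₂, projV x₁ = projV x₂ → ∃ g, σ g x₁ = x₂) ∧ (∀ n ∈ T.N i, σ n = 1) ∧
        -- edges: dictionary
        (∀ y, ∃ L ∈ edgeLikeSubgroups c (projE y),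
          (L.subgroupOf (T.N i)).map (T.adm i).toMonoidHom ∈ edgeLikeSubgroups (T.chart i) y) ∧
        (∀ y (H : Subgroup (T.chart i).G), H ∈ edgeLikeSubgroups (T.chart i) y →
          ∃ L ∈ edgeLikeSubgroups c (projE y), H = (L.subgroupOf (T.N i)).map (T.adm i).toMonoidHom) ∧
        (∀ (e : 𝒢.graph.Edge) (L : Subgroup c.G) y, L ∈ edgeLikeSubgroups c e →
          (L.subgroupOf (T.N i)).map (T.adm i).toMonoidHom ∈ edgeLikeSubgroups (T.chart i) y → projE y = e) ∧
        -- edges: the action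
        (∀ g y, projE (τ g y) = projE y) ∧
        (∀ g y (L : Subgroup c.G), L ∈ edgeLikeSubgroups c (projE y) →
          (L.subgroupOf (T.N i)).map (T.adm i).toMonoidHom ∈ edgeLikeSubgroups (T.chart i) y →
          ((L.map (MulAut.conj g).toMonoidHom).subgroupOf (T.N i)).map (T.adm i).toMonoidHom ∈
            edgeLikeSubgroups (T.chart i) (τ g y)) ∧
        (∀ y₁ y₂, projE y₁ = projE y₂ → ∃ g, τ g y₁ = y₂) ∧ (∀ n ∈ T.N i, τ n = 1) := by
  classical
  haveI := c.secondCountableTopology; haveI := c.isTopologicalGroup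
  have h36 : 𝒢.Prop36Hypotheses := h37.toProp36Hypotheses; have hcoh : 𝒢.IsCoherent := hsc.isCoherent
  have hslim : IsSlimGroup c.G := temperedPiSlim_holds 𝒢 h36 c
  have hED : EdgeLikeDistinctAt 𝒢 := edgeLikeDistinctAt_of_compactInVerticialAt hCV
  let Q : ℕ → BTemp c.G := fun i =>
    ⟨Action.ofMulAction c.G (c.G ⧸ N i), (temperedAction_quotient_iff c.isTempered (N i)).mpr (hopen i)⟩
  have hQconn : ∀ i, IsConnectedObj (Q i) := fun i => by
    refine isConnectedObj_of_transitive (Q i) (QuotientGroup.mk 1 : c.G ⧸ N i) fun x => ?_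
    induction x using QuotientGroup.induction_on with
    | H z => exact ⟨z, by
        change z • (QuotientGroup.mk 1 : c.G ⧸ N i) = QuotientGroup.mk z
        rw [MulAction.Quotient.smul_mk, smul_eq_mul, mul_one]⟩
  have key : ∀ i, ∃ (S : CovObj 𝒢) (hS : S.IsTempered) (hSc : IsConnectedObj (⟨S, hS⟩ : BTempCat 𝒢))
      (cS : TemperedPiChart S.coveringGraph) (ω₀ : BTemp.Orbits (c.equiv.functor.obj ⟨S, hS⟩))
      (φ : BTemp.stab (c.equiv.functor.obj ⟨S, hS⟩) (Quot.out ω₀) →ₜ* cS.G),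
      Nonempty (cS.equiv.inverse ⋙ (S.etaleEquiv uniformSplitting_holds h36 hcoh hS).functor ⋙
          (Over.postEquiv (⟨S, hS⟩ : BTempCat 𝒢) c.equiv).functor ⋙
          BTemp.fibreFamily (c.equiv.functor.obj ⟨S, hS⟩) ⋙
          Pi.eval (fun ω => BTemp (BTemp.stab (c.equiv.functor.obj ⟨S, hS⟩) (Quot.out ω))) ω₀ ≅
        BTemp.res φ) ∧
      Function.Bijective φ ∧ IsOpenMap φ ∧ BTemp.stab (c.equiv.functor.obj ⟨S, hS⟩) (Quot.out ω₀) = N i := by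
    intro i
    let Sobj : BTempCat 𝒢 := c.equiv.inverse.obj (Q i)
    have hSc : IsConnectedObj Sobj := TemperoidTransport.isConnectedObj_functor_obj c.equiv.symm (hQconn i)
    let S : CovObj 𝒢 := Sobj.obj
    have hS : S.IsTempered := Sobj.property; have hSc' : IsConnectedObj (⟨S, hS⟩ : BTempCat 𝒢) := hSc
    let iso : c.equiv.functor.obj ⟨S, hS⟩ ≅ Q i := c.equiv.counitIso.app (Q i)
    let cS : TemperedPiChart S.coveringGraph :=
      S.coveringGraph.temperedPiChart (S.thm37Hypotheses_coveringGraph h37 hsc hS hSc').toProp36Hypotheses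
    let x₀ : (c.equiv.functor.obj ⟨S, hS⟩).obj.V := iso.inv.hom.hom (QuotientGroup.mk 1 : c.G ⧸ N i)
    let ω₀ : BTemp.Orbits (c.equiv.functor.obj ⟨S, hS⟩) := BTemp.cl _ x₀
    obtain ⟨φ, ψ, hψφ, hφψ, hcompat⟩ := CovObj.exists_chartGroup_compatIso h36 hcoh c S hS hSc' cS ω₀
    haveI := hnormal i
    have hUN : BTemp.stab (c.equiv.functor.obj ⟨S, hS⟩) (Quot.out ω₀) = N i := by
      ext g; rw [BTemp.mem_stab_iff_of_iso iso, BTemp.stab_quotient_eq c.isTempered (N i) (hopen i)]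
    have hopenφ : IsOpenMap φ := Homeomorph.isOpenMap
      { toFun := φ, invFun := ψ, left_inv := hψφ, right_inv := hφψ,
        continuous_toFun := φ.continuous, continuous_invFun := ψ.continuous }
    exact ⟨S, hS, hSc', cS, ω₀, φ, hcompat, ⟨Function.LeftInverse.injective hψφ, fun y => ⟨ψ y, hφψ y⟩⟩,
      hopenφ, hUN⟩
  choose S hS hSc cS ω₀ φ hφ hφb hφo hUN using key
  have hadm : ∀ i, ∃ ψ : N i →ₜ* (cS i).G, Function.Surjective ψ ∧ IsOpenMap ψ ∧ ψ.toMonoidHom.ker = ⊥ ∧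
      ∀ K : Subgroup c.G, (K.subgroupOf (N i)).map ψ.toMonoidHom =
        (K.subgroupOf (BTemp.stab (c.equiv.functor.obj ⟨S i, hS i⟩) (Quot.out (ω₀ i)))).map
          (φ i).toMonoidHom := fun i =>
    exists_adm_of_eq'' (hUN i) (φ i) (hφb i).2 (hφo i) ((MonoidHom.ker_eq_bot_iff _).mpr (hφb i).1)
  choose adm hsurj hopenMap hker hadmK using hadm
  refine ⟨{ N := N, N_antitone := hanti, isOpen_N := hopen, N_char := hchar, N_normal := hnormal,
            N_finiteIndex := hfi, N_exhaustive := hexh, Gc := fun i => (S i).coveringGraph,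
            hyp := fun i => (S i).thm37Hypotheses_coveringGraph h37 hsc (hS i) (hSc i),
            chart := fun i => cS i, admKer := fun _ => ⊥, admKer_le := fun _ => bot_le,
            admKer_normal := fun _ => inferInstance, admKer_antitone := fun _ _ _ => le_rfl,
            adm := adm, adm_surjective := hsurj, isOpenMap_adm := hopenMap,
            ker_adm := fun i => by rw [hker i, Subgroup.bot_subgroupOf]
            faithful := fun i g hg => ?_ }, rfl, fun _ => rfl, fun i => ?_⟩
  · have hz : g ∈ Subgroup.centralizer (N i : Set c.G) := by
      rw [Subgroup.mem_centralizer_iff]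
      intro n hn
      have h := hg n hn; rw [Subgroup.mem_bot] at h
      calc n * g = 1 * (n * g) := (one_mul _).symm
        _ = g * n * g⁻¹ * n⁻¹ * (n * g) := by rw [h]
        _ = g * n := by group
    rw [hslim.centralizer_eq_bot _ (hopen i), Subgroup.mem_bot] at hz
    rw [hz]; exact (N i).one_mem
  · -- level `i`: abbreviations and the Part-A lemmas rewritten through `hadmK`
    have h37S : (S i).coveringGraph.Thm37Hypotheses := (S i).thm37Hypotheses_coveringGraph h37 hsc (hS i) (hSc i)
    have hEDS := (S i).edgeLikeDistinctAt_coveringGraph h37 hcoh hCV (hS i) (hSc i)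
    have hmemN : ∀ (u : BTemp.stab (c.equiv.functor.obj ⟨S i, hS i⟩) (Quot.out (ω₀ i))), (u : c.G) ∈ N i :=
      fun u => (hUN i).le u.2
    -- vertices
    have hV1 : ∀ (v : 𝒢.graph.Vertex) (ω : BTemp.Orbits ((S i).SV v)), ∃ K ∈ verticialSubgroups c v,
        (K.subgroupOf (N i)).map (adm i).toMonoidHom ∈
          verticialSubgroups (cS i) (⟨v, ω⟩ : (S i).coveringGraph.graph.Vertex) := fun v ω => by
      obtain ⟨K, hK, hmem⟩ := (S i).exists_trace_mem_verticialSubgroups h36 hcoh c (hS i) (hSc i) (cS i)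
        (ω₀ i) (φ i) (hφ i) v ω
      exact ⟨K, hK, by rw [hadmK]; exact hmem⟩
    have hVfst : ∀ {v v' : 𝒢.graph.Vertex} {ω' : BTemp.Orbits ((S i).SV v')} {K : Subgroup c.G},
        K ∈ verticialSubgroups c v → (K.subgroupOf (N i)).map (adm i).toMonoidHom ∈
          verticialSubgroups (cS i) (⟨v', ω'⟩ : (S i).coveringGraph.graph.Vertex) → v' = v :=
      fun {v v' ω' K} hK h => by
      rw [hadmK] at h
      exact (S i).fst_eq_of_trace_mem_verticialSubgroups h36 hcoh c (hS i) (hSc i) (cS i) (ω₀ i) (φ i) (hφ i)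
        h37 (hφb i) hK h
    have hVsame : ∀ {v : 𝒢.graph.Vertex} {ω : BTemp.Orbits ((S i).SV v)} {K : Subgroup c.G} (n : c.G),
        n ∈ N i → (K.subgroupOf (N i)).map (adm i).toMonoidHom ∈
          verticialSubgroups (cS i) (⟨v, ω⟩ : (S i).coveringGraph.graph.Vertex) →
        ((K.map (MulAut.conj n).toMonoidHom).subgroupOf (N i)).map (adm i).toMonoidHom ∈
          verticialSubgroups (cS i) (⟨v, ω⟩ : (S i).coveringGraph.graph.Vertex) := fun {v ω K} n hn h => by
      rw [hadmK] at h ⊢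
      have hn' : n ∈ BTemp.stab (c.equiv.functor.obj ⟨S i, hS i⟩) (Quot.out (ω₀ i)) := by rw [hUN i]; exact hn
      exact (S i).traces_same_vertex_of_mem_stab c (hS i) (cS i) (ω₀ i) (φ i) h ⟨n, hn'⟩
    have hVconj : ∀ {v : 𝒢.graph.Vertex} {ω : BTemp.Orbits ((S i).SV v)} {K K' : Subgroup c.G},
        K ∈ verticialSubgroups c v → K' ∈ verticialSubgroups c v →
        (K.subgroupOf (N i)).map (adm i).toMonoidHom ∈
          verticialSubgroups (cS i) (⟨v, ω⟩ : (S i).coveringGraph.graph.Vertex) →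
        (K'.subgroupOf (N i)).map (adm i).toMonoidHom ∈
          verticialSubgroups (cS i) (⟨v, ω⟩ : (S i).coveringGraph.graph.Vertex) →
        ∃ n ∈ N i, K' = K.map (MulAut.conj n).toMonoidHom := fun {v ω K K'} hK hK' h h' => by
      rw [hadmK] at h h'
      obtain ⟨u, hu⟩ := (S i).exists_mem_stab_conj_eq_of_traces_same_vertex c (hS i) (cS i) (ω₀ i) (φ i) h37
        (hφb i) hK hK' h h'
      exact ⟨(u : c.G), hmemN u, hu⟩
    have hVuniq : ∀ (v : 𝒢.graph.Vertex) {K : Subgroup c.G}, K ∈ verticialSubgroups c v →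
        ∃! ω : BTemp.Orbits ((S i).SV v), (K.subgroupOf (N i)).map (adm i).toMonoidHom ∈
          verticialSubgroups (cS i) (⟨v, ω⟩ : (S i).coveringGraph.graph.Vertex) := fun v K hK => by
      rw [hadmK]
      exact (S i).existsUnique_orbit_trace_mem_verticialSubgroups h36 hcoh c (hS i) (hSc i) (cS i) (ω₀ i) (φ i)
        (hφ i) h37 hsc v hK
    -- edges
    have hE1 : ∀ (e : 𝒢.graph.Edge) (ω : BTemp.Orbits ((S i).SE e)), ∃ L ∈ edgeLikeSubgroups c e,
        (L.subgroupOf (N i)).map (adm i).toMonoidHom ∈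
          edgeLikeSubgroups (cS i) (⟨e, ω⟩ : (S i).coveringGraph.graph.Edge) := fun e ω => by
      obtain ⟨L, hL, hmem⟩ := (S i).exists_traceE_mem_edgeLikeSubgroups h36 hcoh c (hS i) (hSc i) (cS i)
        (ω₀ i) (φ i) (hφ i) e ω
      exact ⟨L, hL, by rw [hadmK]; exact hmem⟩
    have hEfst : ∀ {e e' : 𝒢.graph.Edge} {ω' : BTemp.Orbits ((S i).SE e')} {L : Subgroup c.G},
        L ∈ edgeLikeSubgroups c e → (L.subgroupOf (N i)).map (adm i).toMonoidHom ∈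
          edgeLikeSubgroups (cS i) (⟨e', ω'⟩ : (S i).coveringGraph.graph.Edge) → e' = e :=
      fun {e e' ω' L} hL h => by
      rw [hadmK] at h
      exact (S i).fst_eq_of_traceE_mem_edgeLikeSubgroups h36 hcoh c (hS i) (hSc i) (cS i) (ω₀ i) (φ i) (hφ i)
        h37 hED (hφb i) hL h
    have hEsame : ∀ {e : 𝒢.graph.Edge} {ω : BTemp.Orbits ((S i).SE e)} {L : Subgroup c.G} (n : c.G),
        n ∈ N i → (L.subgroupOf (N i)).map (adm i).toMonoidHom ∈
          edgeLikeSubgroups (cS i) (⟨e, ω⟩ : (S i).coveringGraph.graph.Edge) →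
        ((L.map (MulAut.conj n).toMonoidHom).subgroupOf (N i)).map (adm i).toMonoidHom ∈
          edgeLikeSubgroups (cS i) (⟨e, ω⟩ : (S i).coveringGraph.graph.Edge) := fun {e ω L} n hn h => by
      rw [hadmK] at h ⊢
      have hn' : n ∈ BTemp.stab (c.equiv.functor.obj ⟨S i, hS i⟩) (Quot.out (ω₀ i)) := by rw [hUN i]; exact hn
      exact (S i).tracesE_same_edge_of_mem_stab c (hS i) (cS i) (ω₀ i) (φ i) h ⟨n, hn'⟩
    have hEconj : ∀ {e : 𝒢.graph.Edge} {ω : BTemp.Orbits ((S i).SE e)} {L L' : Subgroup c.G},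
        L ∈ edgeLikeSubgroups c e → L' ∈ edgeLikeSubgroups c e →
        (L.subgroupOf (N i)).map (adm i).toMonoidHom ∈
          edgeLikeSubgroups (cS i) (⟨e, ω⟩ : (S i).coveringGraph.graph.Edge) →
        (L'.subgroupOf (N i)).map (adm i).toMonoidHom ∈
          edgeLikeSubgroups (cS i) (⟨e, ω⟩ : (S i).coveringGraph.graph.Edge) →
        ∃ n ∈ N i, L' = L.map (MulAut.conj n).toMonoidHom := fun {e ω L L'} hL hL' h h' => by
      rw [hadmK] at h h'
      obtain ⟨u, hu⟩ := (S i).exists_mem_stab_conj_eq_of_tracesE_same_edge c (hS i) (cS i) (ω₀ i) (φ i)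
        (hφb i) (fun hL hL' hc => hCT e _ _ hL hL' hc) hL hL' h h'
      exact ⟨(u : c.G), hmemN u, hu⟩
    have hEuniq : ∀ (e : 𝒢.graph.Edge) {L : Subgroup c.G}, L ∈ edgeLikeSubgroups c e →
        ∃! ω : BTemp.Orbits ((S i).SE e), (L.subgroupOf (N i)).map (adm i).toMonoidHom ∈
          edgeLikeSubgroups (cS i) (⟨e, ω⟩ : (S i).coveringGraph.graph.Edge) := fun e L hL => by
      rw [hadmK]
      exact (S i).existsUnique_orbit_traceE_mem_edgeLikeSubgroups h36 hcoh c (hS i) (cS i) (ω₀ i) (φ i) (hφ i)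
        h37S hEDS e hL
    -- the two actions, from the generic lemma
    let specV : c.G → (S i).coveringGraph.graph.Vertex → (S i).coveringGraph.graph.Vertex → Prop :=
      fun g x w => w.1 = x.1 ∧ ∀ K ∈ verticialSubgroups c x.1,
        (K.subgroupOf (N i)).map (adm i).toMonoidHom ∈ verticialSubgroups (cS i) x →
        ((K.map (MulAut.conj g).toMonoidHom).subgroupOf (N i)).map (adm i).toMonoidHom ∈
          verticialSubgroups (cS i) w
    have hVex : ∀ g x, ∃! w, specV g x w := by
      rintro g ⟨v, ω⟩
      obtain ⟨K₁, hK₁, h₁⟩ := hV1 v ω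
      have hgK₁ : K₁.map (MulAut.conj g).toMonoidHom ∈ verticialSubgroups c v := conj_mem_verticialSubgroups c hK₁ g
      obtain ⟨ω₂, hω₂, -⟩ := hVuniq v hgK₁
      refine ⟨⟨v, ω₂⟩, ⟨rfl, fun K hK hKx => ?_⟩, ?_⟩
      · obtain ⟨n, hn, rfl⟩ := hVconj hK₁ hK h₁ hKx
        rw [map_conj_conj_swap K₁ g n]
        exact hVsame (g * n * g⁻¹) ((hnormal i).conj_mem n hn g) hω₂
      · rintro ⟨v', ω'⟩ ⟨hv', hall⟩
        change v' = v at hv'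
        subst hv'
        by_contra hne
        have h0 := (verticialDistinct_holds _ h37S (cS i)).1 _ _ _ _ (hall K₁ hK₁ h₁) hω₂ hne
        rw [Subgroup.relIndex_self] at h0
        exact one_ne_zero h0
    obtain ⟨σ, hσ⟩ := exists_perm_hom_of_existsUnique specV hVex
      (fun x => ⟨rfl, fun K _ hKx => by rw [map_conj_one']; exact hKx⟩)
      (fun g h x y z hy hz => ⟨hz.1.trans hy.1, fun K hK hKx => by
        rw [map_conj_mul']
        refine hz.2 _ ?_ (hy.2 K hK hKx)
        rw [hy.1]; exact conj_mem_verticialSubgroups c hK h⟩)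
    let specE : c.G → (S i).coveringGraph.graph.Edge → (S i).coveringGraph.graph.Edge → Prop :=
      fun g y w => w.1 = y.1 ∧ ∀ L ∈ edgeLikeSubgroups c y.1,
        (L.subgroupOf (N i)).map (adm i).toMonoidHom ∈ edgeLikeSubgroups (cS i) y →
        ((L.map (MulAut.conj g).toMonoidHom).subgroupOf (N i)).map (adm i).toMonoidHom ∈
          edgeLikeSubgroups (cS i) w
    have hEex : ∀ g y, ∃! w, specE g y w := by
      rintro g ⟨e, ω⟩
      obtain ⟨L₁, hL₁, h₁⟩ := hE1 e ω
      have hgL₁ : L₁.map (MulAut.conj g).toMonoidHom ∈ edgeLikeSubgroups c e := conj_mem_edgeLikeSubgroups' c hL₁ g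
      obtain ⟨ω₂, hω₂, -⟩ := hEuniq e hgL₁
      refine ⟨⟨e, ω₂⟩, ⟨rfl, fun L hL hLy => ?_⟩, ?_⟩
      · obtain ⟨n, hn, rfl⟩ := hEconj hL₁ hL h₁ hLy
        rw [map_conj_conj_swap L₁ g n]
        exact hEsame (g * n * g⁻¹) ((hnormal i).conj_mem n hn g) hω₂
      · rintro ⟨e', ω'⟩ ⟨he', hall⟩
        change e' = e at he'
        subst he'
        by_contra hne
        have h0 := hEDS h37S (cS i) _ _ _ _ (hall L₁ hL₁ h₁) hω₂ hne
        rw [Subgroup.relIndex_self] at h0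
        exact one_ne_zero h0
    obtain ⟨τ, hτ⟩ := exists_perm_hom_of_existsUnique specE hEex
      (fun y => ⟨rfl, fun L _ hLy => by rw [map_conj_one']; exact hLy⟩)
      (fun g h x y z hy hz => ⟨hz.1.trans hy.1, fun L hL hLx => by
        rw [map_conj_mul']
        refine hz.2 _ ?_ (hy.2 L hL hLx)
        rw [hy.1]; exact conj_mem_edgeLikeSubgroups' c hL h⟩)
    refine ⟨S i, hS i, rfl, fun x => x.1, fun y => y.1, σ, τ, hSc i, ?_, ?_, ?_, ?_, ?_,
      fun g x => (hσ g x).1, fun g x K hK hKx => (hσ g x).2 K hK hKx, ?_, ?_, ?_, ?_, ?_,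
      fun g y => (hτ g y).1, fun g y L hL hLy => (hτ g y).2 L hL hLy, ?_, ?_⟩
    · intro v
      obtain ⟨χ₀, hχ₀⟩ := exists_isVerticialHom h36.isQuasiCoherent h36.isGaloisCountable c v
      obtain ⟨ω, -⟩ := (S i).exists_isVerticialHom_coveringGraph h36 hcoh c (hS i) (cS i) (ω₀ i) (φ i) (hφ i)
        v χ₀ hχ₀
      exact ⟨⟨v, ω⟩, rfl⟩
    · intro e
      obtain ⟨v₀⟩ := h36.hasVertex
      obtain ⟨b, hbe, hb⟩ := SemiGraph.exists_abuts_of_isConnected h36.isConnected v₀ e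
      obtain ⟨v, hv⟩ := Option.isSome_iff_exists.mp hb
      subst hbe
      obtain ⟨χ₀, hχ₀⟩ := exists_isEdgeHom h36.isQuasiCoherent h36.isGaloisCountable h36.isOfInjectiveType c b v hv
      obtain ⟨ω, -⟩ := (S i).exists_isEdgeHom_coveringGraph h36 hcoh c (hS i) (cS i) (ω₀ i) (φ i) (hφ i) _ χ₀ hχ₀
      exact ⟨⟨_, ω⟩, rfl⟩
    · rintro ⟨v, ω⟩
      exact hV1 v ω
    · rintro ⟨v, ω⟩ H hH
      obtain ⟨K, hK, hHK⟩ := (S i).exists_trace_eq_of_mem_verticialSubgroups h36 hcoh c (hS i) (hSc i) (cS i)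
        (ω₀ i) (φ i) (hφ i) (hφb i) v ω hH
      exact ⟨K, hK, by rw [hadmK]; exact hHK⟩
    · rintro v K ⟨v', ω'⟩ hK h
      exact hVfst hK h
    · rintro ⟨v, ω₁⟩ ⟨v', ω₂⟩ hvv
      change v = v' at hvv
      subst hvv
      obtain ⟨K₁, hK₁, h₁⟩ := hV1 v ω₁
      obtain ⟨K₂, hK₂, h₂⟩ := hV1 v ω₂
      obtain ⟨γ, rfl⟩ := exists_conj_of_mem_verticialSubgroups c hK₁ hK₂
      refine ⟨γ, (hVex γ ⟨v, ω₁⟩).unique (hσ γ _) ⟨rfl, fun K hK hKx => ?_⟩⟩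
      obtain ⟨n, hn, rfl⟩ := hVconj hK₁ hK h₁ hKx
      rw [map_conj_conj_swap K₁ γ n]
      exact hVsame (γ * n * γ⁻¹) ((hnormal i).conj_mem n hn γ) h₂
    · intro n hn
      exact Equiv.ext fun x => (hVex n x).unique (hσ n _) ⟨rfl, fun K _ hKx => hVsame n hn hKx⟩
    · rintro ⟨e, ω⟩
      exact hE1 e ω
    · rintro ⟨e, ω⟩ H hH
      obtain ⟨L, hL, hHL⟩ := (S i).exists_traceE_eq_of_mem_edgeLikeSubgroups h36 hcoh c (hS i) (hSc i) (cS i)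
        (ω₀ i) (φ i) (hφ i) (hφb i) e ω hH
      exact ⟨L, hL, by rw [hadmK]; exact hHL⟩
    · rintro e L ⟨e', ω'⟩ hL h
      exact hEfst hL h
    · rintro ⟨e, ω₁⟩ ⟨e', ω₂⟩ hee
      change e = e' at hee
      subst hee
      obtain ⟨L₁, hL₁, h₁⟩ := hE1 e ω₁
      obtain ⟨L₂, hL₂, h₂⟩ := hE1 e ω₂
      obtain ⟨γ, rfl⟩ := exists_conj_of_mem_edgeLikeSubgroups c hL₁ hL₂
      refine ⟨γ, (hEex γ ⟨e, ω₁⟩).unique (hτ γ _) ⟨rfl, fun L hL hLy => ?_⟩⟩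
      obtain ⟨n, hn, rfl⟩ := hEconj hL₁ hL h₁ hLy
      rw [map_conj_conj_swap L₁ γ n]
      exact hEsame (γ * n * γ⁻¹) ((hnormal i).conj_mem n hn γ) h₂
    · intro n hn
      exact Equiv.ext fun y => (hEex n y).unique (hτ n _) ⟨rfl, fun L _ hLy => hEsame n hn hLy⟩

end SpecialFibreTower

end Literature.AnabelianGeometry.SemiGraphs

end
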